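import Mathlib
import HarnessLib
import Summits.KontsevichZagierPeriods.Zeta5Search.DougallCarlsonSides

/-!
# ζ(5) search — the series side of Dougall's Carlson function: termwise bound, holomorphy, boundedness
(cell `pub-zeta5`, ct-1 g26)

HONEST FRAMING: systematic search; no irrationality claim unless kernel-certified.  Elementary estimates and a
Weierstrass-M statement; nothing here is an irrationality result; no named fact is discharged.

Part of brick B5e of `HOME/ct-1/g26/VWP-BLUEPRINT.md` (§3 B5, refined form for REAL `h₀ > −1`).  The series side of the
Carlson function is `S(z) = Σ_μ c_μ · (−z)_μ/(h₀+1+z)_μ` with coefficients `c_μ` independent of `z` (for Dougall: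
`c_μ = (h₀+2μ)Γ(h₀+μ)Γ(h₁+μ)Γ(h₂+μ)/(Γ(μ+1)Γ(h₀−h₁+1+μ)Γ(h₀−h₂+1+μ))`; here `c` is ARBITRARY):

* `norm_neg_add_nat_le`, `norm_rf_neg_le_norm_rf`, `norm_ratio_le_one` — on the half-plane `Re z > −(1+h₀)/2` every
  factor satisfies `|i − z| ≤ |h₀+1+i+z|` (the difference of squares is `(h₀+1+2 Re z)(h₀+1+2i) ≥ 0`), hence
  `‖(−z)_μ/(h₀+1+z)_μ‖ ≤ 1`;
* `differentiableOn_series` — if `Σ‖c_μ‖ < ∞` then `S` is holomorphic on that half-plane (Mathlib's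
  `Complex.differentiableOn_tsum_of_summable_norm` with the constant majorant `‖c_μ‖`);
* `norm_series_le` — and `‖S(z)‖ ≤ Σ‖c_μ‖` there (in particular `S` is bounded on `{Re z ≥ 0}`, as Carlson's theorem wants).
The summability of the Dougall coefficients (`c_μ ~ μ^{2(h₁+h₂)−h₀−2}`, summable iff `2(h₁+h₂) < 1+h₀`) is the other
half of B5e and is NOT in this file.  Theorems only (no new definitions).
-/

noncomputable section

namespace Summit.KontsevichZagierPeriods.Zeta5Search.DougallSeriesSide

open Finset Filter
open Summit.KontsevichZagierPeriods.Zeta5Search.HypergeometricWhipple (rf rf_zero rf_succ)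
open Summit.KontsevichZagierPeriods.Zeta5Search.DougallTerminatingGamma (rf_ne_zero)
open Summit.KontsevichZagierPeriods.Zeta5Search.DougallCarlsonSides (differentiableAt_series_term)

variable {h₀ : ℝ} {z : ℂ}

/-- **Factor comparison**: for `h₀ > −1` and `Re z > −(1+h₀)/2`, `|i − z| ≤ |h₀+1+z+i|` for every natural `i`. -/
theorem norm_neg_add_nat_le (hh : -1 < h₀) (hz : -(1 + h₀) / 2 < z.re) (i : ℕ) :
    ‖-z + (i : ℂ)‖ ≤ ‖(h₀ : ℂ) + 1 + z + i‖ := by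
  rw [Complex.norm_def, Complex.norm_def]
  refine Real.sqrt_le_sqrt ?_
  rw [Complex.normSq_apply, Complex.normSq_apply]
  simp only [Complex.add_re, Complex.neg_re, Complex.natCast_re, Complex.add_im, Complex.neg_im,
    Complex.natCast_im, Complex.ofReal_re, Complex.ofReal_im, Complex.one_re, Complex.one_im]
  have hi : (0 : ℝ) ≤ i := i.cast_nonneg
  nlinarith [mul_nonneg (show (0 : ℝ) ≤ h₀ + 1 + 2 * z.re by linarith) (show (0 : ℝ) ≤ h₀ + 1 + 2 * i by linarith)]

/-- `‖(−z)_μ‖ ≤ ‖(h₀+1+z)_μ‖` on the half-plane `Re z > −(1+h₀)/2`. -/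
theorem norm_rf_neg_le_norm_rf (hh : -1 < h₀) (hz : -(1 + h₀) / 2 < z.re) (μ : ℕ) :
    ‖rf (-z) μ‖ ≤ ‖rf ((h₀ : ℂ) + 1 + z) μ‖ := by
  induction μ with
  | zero => simp [rf_zero]
  | succ μ ih =>
    rw [rf_succ, rf_succ, norm_mul, norm_mul]
    exact mul_le_mul ih (norm_neg_add_nat_le hh hz μ) (norm_nonneg _) (norm_nonneg _)

/-- No zero of the denominator block on the half-plane `Re z > −(1+h₀)/2` (indeed on `Re z > −(1+h₀)`). -/
theorem rf_shift_ne_zero (hh : -1 < h₀) (hz : -(1 + h₀) / 2 < z.re) (μ : ℕ) : rf ((h₀ : ℂ) + 1 + z) μ ≠ 0 := by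
  refine rf_ne_zero (fun n h => ?_) μ
  have := congrArg Complex.re h
  simp at this
  linarith [n.cast_nonneg (α := ℝ)]

/-- **Termwise bound**: `‖(−z)_μ/(h₀+1+z)_μ‖ ≤ 1` for `h₀ > −1`, `Re z > −(1+h₀)/2`. -/
theorem norm_ratio_le_one (hh : -1 < h₀) (hz : -(1 + h₀) / 2 < z.re) (μ : ℕ) :
    ‖rf (-z) μ / rf ((h₀ : ℂ) + 1 + z) μ‖ ≤ 1 := by
  rw [norm_div, div_le_one (norm_pos_iff.2 (rf_shift_ne_zero hh hz μ))]
  exact norm_rf_neg_le_norm_rf hh hz μ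

/-- **Holomorphy of the series side** (Weierstrass M-test): for `h₀ > −1` and absolutely summable coefficients `c`,
`z ↦ Σ_μ c_μ·(−z)_μ/(h₀+1+z)_μ` is holomorphic on `{Re z > −(1+h₀)/2}`. -/
theorem differentiableOn_series (hh : -1 < h₀) {c : ℕ → ℂ} (hc : Summable fun μ => ‖c μ‖) :
    DifferentiableOn ℂ (fun z : ℂ => ∑' μ : ℕ, c μ * (rf (-z) μ / rf ((h₀ : ℂ) + 1 + z) μ))
      {z : ℂ | -(1 + h₀) / 2 < z.re} := by
  refine Complex.differentiableOn_tsum_of_summable_norm hc (fun μ => ?_)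
    (isOpen_lt continuous_const Complex.continuous_re) (fun μ w hw => ?_)
  · intro w hw
    exact ((differentiableAt_series_term (h₀ : ℂ) μ (rf_shift_ne_zero hh hw μ)).const_mul (c μ)).differentiableWithinAt
  · rw [norm_mul]
    exact mul_le_of_le_one_right (norm_nonneg _) (norm_ratio_le_one hh hw μ)

/-- **Boundedness of the series side**: `‖Σ_μ c_μ·(−z)_μ/(h₀+1+z)_μ‖ ≤ Σ_μ ‖c_μ‖` on `{Re z > −(1+h₀)/2}`. -/
theorem norm_series_le (hh : -1 < h₀) {c : ℕ → ℂ} (hc : Summable fun μ => ‖c μ‖) (hz : -(1 + h₀) / 2 < z.re) :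
    ‖∑' μ : ℕ, c μ * (rf (-z) μ / rf ((h₀ : ℂ) + 1 + z) μ)‖ ≤ ∑' μ : ℕ, ‖c μ‖ := by
  refine tsum_of_norm_bounded hc.hasSum fun μ => ?_
  rw [norm_mul]
  exact mul_le_of_le_one_right (norm_nonneg _) (norm_ratio_le_one hh hz μ)

/-- The series side is summable at every point of the half-plane (comparison with `Σ‖c_μ‖`). -/
theorem summable_series (hh : -1 < h₀) {c : ℕ → ℂ} (hc : Summable fun μ => ‖c μ‖) (hz : -(1 + h₀) / 2 < z.re) :
    Summable fun μ : ℕ => c μ * (rf (-z) μ / rf ((h₀ : ℂ) + 1 + z) μ) := by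
  refine Summable.of_norm_bounded hc fun μ => ?_
  rw [norm_mul]
  exact mul_le_of_le_one_right (norm_nonneg _) (norm_ratio_le_one hh hz μ)

end Summit.KontsevichZagierPeriods.Zeta5Search.DougallSeriesSide

end
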